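import Literature.NumberTheory.LFunctions.Zhang2022.Section3PhiFlat
import Literature.NumberTheory.LFunctions.Zhang2022.Section3Lemma31
import Literature.Analysis.Complex.VerticalLineShiftPoles
import HarnessLib

/-!
# Zhang (2022) §3, the input-free variant "Lemma 3.2♭":
# `∑_{D⁴ < n ≤ D⁸} ν(n)² d(n)/n ≪ 𝓛^{-2015}` under (A), kernel-checked

Topic `Literature/NumberTheory/LFunctions/Zhang2022` (Landau–Siegel autopsy tree; verdict-neutral).
Y. Zhang, *Discrete mean estimates and the Landau–Siegel zero*, arXiv:2211.02515v1 — **an unrefereed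
manuscript, a claimed result under adjudication** — §3, Lemma 3.2 ("`∑_{D⁴<n≤D⁸} ν(n)²τ₂(n)²/n
≪ 𝓛^{-2007}`", proof sketched through `ζ⁸L⁸φ*`, which needs a subconvex bound for `L(s,χ)` —
the cell's flag F7). The autopsy cell's ALT-1 report (§4, family A11) replaces it, for the purposes
of Lemma 3.6, by the elementary reduction of `Section3SigmaSplitting.lean` plus the FOUR-factor
moment bound

  **Lemma 3.2♭.** Under (A) (`L(1,χ) ≤ 𝓛^{-2022}`, `χ` real primitive mod `D`, `𝓛 = log D`):
  `∑_{D⁴ < n ≤ D⁸} ν(n)² d(n)/n ≪ 𝓛^{-2015}`.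

This file PROVES Lemma 3.2♭ (`lemma_3_2_flat`; threshold `log D ≥ 3`, explicit constant involving
the tree's divisor-bound constant), by the manuscript's own method for Lemma 3.1 with the generating
function `∑ ν²d n^{-s} = ζ(s)⁴L(s,χ)⁴φ♭(s)` of `Section3PhiFlat.lean`: smoothing
`1_{(D⁴,D⁸]} ≤ 6(e^{-n/D⁸} − e^{-n/D⁴})`, Mellin on `re z = 2`
(`ZetaM4.integral_GammaK_cpow_LSeries_two`), shift to `re z = −1/4` across the pole of ORDER FOUR at
`z = 0` by the tree's general strip theorem `Literature.Analysis.Complex.integral_vertical_sub_eq_sum_of_poles`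
(residue `h‴(0)/3!` for the integrand `h(z)/z⁴`, `h = ζ₁(1+z)⁴Γ(z+1)ε(z)L(1+z,χ)⁴φ♭(1+z)`), Cauchy's
estimate `‖h‴(0)‖ ≤ 3!·max_{|z|=r}‖h‖/r³` on `r = 𝓛^{-2024}` (Mathlib
`Complex.norm_iteratedDeriv_le_of_forall_mem_sphere_norm_le`) where `‖L(1+z,χ)‖ ≤ (1+4e^{9/2})𝓛^{-2022}`
(`Lemma31.norm_LFunction_one_add_sub_le` + (A)), `‖φ♭(1+z)‖ ≤ e^{35 P}` (`PhiFlat.norm_phiFlat_le_of_re_cpow_nonneg`),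
`‖ε(z)‖ ≤ 8e⁴𝓛`: the residue term is `O(𝓛 · 𝓛^{-8088} · 𝓛^{3·2024}) = O(𝓛^{-2015})`; and on the line
`re z = −1/4` the `D`-power is `D^{4·(1/2)(1/4)} · D^{2η} · D^{-1} = D^{-1/4}` (`η = 1/8`; the tree's
Pólya–Vinogradov-strength bound `DirichletAbel.norm_LFunction_le_polyaVinogradov_of_half_le` —
a convexity-strength exponent `1/4` suffices for FOUR `L`-factors against the cut `D⁴`: in the
bookkeeping `Saves k a μ := 2kμ < a` of `Section3SubconvexInput.lean`, `2·4·(1/4) = 2 < 4`). This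
formalises the "consequence recorded by the cell (not formalised here, it is analytic)" paragraph of
`Section3SigmaSplitting.lean`; combined with `sum_sigma_sq_div_le_source_log_pow` there it yields the
input `E ≪ 𝓛^{-2007}` of the manuscript's Lemma 3.6 without any subconvexity (ALT-1 §4, A11).
No statement about the manuscript's Theorems 1–2 is made or implied; the cell's verdict (gap at
(8.24)) is independent of §3.

## References

* Y. Zhang, arXiv:2211.02515 (2022), §3, Lemmas 3.1–3.2. [cite: Zhang2022LandauSiegel, §3, Lemma 3.2]
-/

noncomputable section

open Complex Filter Topology Set MeasureTheory Real Metric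
open scoped LSeries.notation

namespace Literature.NumberTheory.LFunctions.Zhang2022.Lemma32Flat

open Literature.NumberTheory.LFunctions.DivisorSumCharSq (eps eps_of_ne_zero eps_zero
  differentiable_eps W W_eq_tsum integral_Gamma_cpow_LSeries_eq integrable_Gamma_cpow_LSeries
  MX rpow_le_rpow_add Zconst Zconst_nonneg norm_LFunction_one_add_le)
open Literature.NumberTheory.LFunctions.Zhang2022.Lemma31 (W_ofReal summable_mul_exp_div
  one_sixth_le_exp_sub_exp norm_LFunction_le_near_one norm_LFunction_one_add_sub_le
  ne_one_of_isPrimitive divisorSumChar_im_eq_zero eight_lt_exp_three)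
open Literature.NumberTheory.LFunctions.Zhang2022.PhiFlat (phiFlat factor differentiableOn_phiFlat
  norm_phiFlat_le norm_phiFlat_le_of_re_cpow_nonneg LSeries_nu_sq_tau_eq re_natCast_cpow_neg_nonneg)
open Literature.NumberTheory.LFunctions.ZetaM4 (CΓ CΓ_pos norm_Gamma_strip_le pow_mul_exp_le
  integrable_pow_mul_exp integral_pow_mul_exp_le exists_pow_mul_exp_le)

variable {D : ℕ} [NeZero D] (χ : DirichletCharacter ℂ D)

/-! ### §1. The objects -/

/-- The coefficients `f(n) = ν(n)² d(n)`. [folklore] -/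
def coeff (n : ℕ) : ℂ := divisorSumChar χ n ^ 2 * (n.divisors.card : ℂ)

/-- `g(z) = L(1+z, χ)⁴ φ♭(1+z)`. [folklore] -/
def gF (z : ℂ) : ℂ := χ.LFunction (1 + z) ^ 4 * phiFlat χ (1 + z)

variable (A B : ℝ)

/-- The regularised numerator `h(z) = ζ₁(1+z)⁴ Γ(z+1) ε(z) g(z)` (holomorphic on `re z > −1/2`).
[folklore] -/
def hnum (z : ℂ) : ℂ :=
  riemannZeta₁ (1 + z) ^ 4 * Complex.Gamma (z + 1) * eps A B z * gF χ z

/-- The integrand `F(z) = ζ(1+z)⁴ Γ(z) (B^z − A^z) g(z)`. [folklore] -/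
def Fint (z : ℂ) : ℂ :=
  riemannZeta (1 + z) ^ 4 * Complex.Gamma z * ((B : ℂ) ^ z - (A : ℂ) ^ z) * gF χ z

variable {A B}

/-- Off `z = 0` (and off the poles of `Γ`), `F(z) = h(z)/z⁴`. [folklore] -/
theorem Fint_eq_hnum_div {z : ℂ} (hz : z ≠ 0) (hz' : ∀ m : ℕ, z ≠ -(m : ℂ)) :
    Fint χ A B z = hnum χ A B z / (z - 0) ^ (3 + 1) := by
  have h1 : (1 : ℂ) + z ≠ 1 := by intro h; exact hz (by linear_combination h)
  rw [Fint, hnum, LFunctions.riemannZeta₁_eq_mul h1, Complex.Gamma_add_one _ hz,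
    eps_of_ne_zero _ _ hz, sub_zero, add_sub_cancel_left]
  have := hz' 0
  field_simp
  ring

/-- `∑ f(n) n^{-(1+z)} = ζ(1+z)⁴ g(z)` for `re z > 0` (`χ² = 1`). [folklore] -/
theorem LSeries_coeff_one_add (hχ : χ ^ 2 = 1) {z : ℂ} (hz : 0 < z.re) :
    L (coeff χ) (1 + z) = riemannZeta (1 + z) ^ 4 * gF χ z := by
  have h1 : 1 < (1 + z).re := by simp; linarith
  have := LSeries_nu_sq_tau_eq χ hχ h1
  show L (fun n => divisorSumChar χ n ^ 2 * (n.divisors.card : ℂ)) (1 + z) = _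
  rw [this, gF, DirichletCharacter.LFunction_eq_LSeries χ h1]
  ring

/-- `g` is differentiable on `re z > −1/2` (`χ` non-trivial, `χ² = 1`). [folklore] -/
theorem differentiableOn_gF (hχ : χ ^ 2 = 1) (hχ1 : χ ≠ 1) :
    DifferentiableOn ℂ (gF χ) {z : ℂ | -(1 / 2) < z.re} := by
  intro z hz
  have hz' : -(1 / 2) < z.re := hz
  have h1 : DifferentiableAt ℂ (fun z : ℂ => (1 : ℂ) + z) z := differentiableAt_id.const_add _
  have hL : DifferentiableAt ℂ (fun z : ℂ => χ.LFunction (1 + z) ^ 4) z :=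
    ((DirichletCharacter.differentiable_LFunction hχ1).differentiableAt.comp z h1).pow 4
  have hopen : IsOpen {s : ℂ | 1 / 2 < s.re} := isOpen_lt continuous_const Complex.continuous_re
  have hφ : DifferentiableAt ℂ (phiFlat χ) (1 + z) :=
    (differentiableOn_phiFlat χ hχ).differentiableAt (hopen.mem_nhds (by simp; linarith))
  exact (hL.mul (hφ.comp z h1)).differentiableWithinAt

/-- `h` is differentiable on `re z > −1/2`. [folklore] -/
theorem differentiableOn_hnum (hχ : χ ^ 2 = 1) (hχ1 : χ ≠ 1) (hA : 0 < A) (hB : 0 < B) :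
    DifferentiableOn ℂ (hnum χ A B) {z : ℂ | -(1 / 2) < z.re} := by
  intro z hz
  have hz' : -(1 / 2) < z.re := hz
  refine DifferentiableWithinAt.mul ?_ (differentiableOn_gF χ hχ hχ1 z hz)
  refine DifferentiableAt.differentiableWithinAt ?_
  refine DifferentiableAt.mul (DifferentiableAt.mul ?_ ?_) ((differentiable_eps hA hB) z)
  · exact ((differentiable_riemannZeta₁.comp
      ((differentiable_const (1 : ℂ)).add differentiable_id)) z).pow 4
  · refine (Complex.differentiableAt_Gamma _ fun m hm => ?_).comp z (differentiableAt_id.add_const 1)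
    have := congrArg Complex.re hm
    simp at this
    have h0 : (0 : ℝ) ≤ m := Nat.cast_nonneg m
    linarith

/-- `F` is differentiable on `re z > −1/2` away from `z = 0`. [folklore] -/
theorem differentiableOn_Fint (hχ : χ ^ 2 = 1) (hχ1 : χ ≠ 1) (hA : 0 < A) (hB : 0 < B) :
    DifferentiableOn ℂ (Fint χ A B) ({z : ℂ | -(1 / 2) < z.re} \ {0}) := by
  intro z hz
  have hz1 : -(1 / 2) < z.re := hz.1
  have hz0 : z ≠ 0 := hz.2
  refine DifferentiableWithinAt.mul ?_ ((differentiableOn_gF χ hχ hχ1 z hz.1).mono fun x hx => hx.1)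
  refine DifferentiableAt.differentiableWithinAt ?_
  refine DifferentiableAt.mul (DifferentiableAt.mul ?_ ?_) ?_
  · have h1 : (1 : ℂ) + z ≠ 1 := by intro h; exact hz0 (by linear_combination h)
    exact ((differentiableAt_riemannZeta h1).comp z (differentiableAt_id.const_add _)).pow 4
  · refine Complex.differentiableAt_Gamma _ fun m hm => ?_
    rcases Nat.eq_zero_or_pos m with rfl | hm0
    · exact hz0 (by simpa using hm)
    · have := congrArg Complex.re hm
      simp at this
      have h1 : (1 : ℝ) ≤ m := by exact_mod_cast hm0
      linarith
  · exact (differentiableAt_id.const_cpow (Or.inl (ofReal_ne_zero.2 hB.ne'))).sub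
      (differentiableAt_id.const_cpow (Or.inl (ofReal_ne_zero.2 hA.ne')))

/-! ### §2. The line `re z = 2`: Mellin -/

omit [NeZero D] in
/-- `|f(n)| ≤ C n` (`d(n)³ ≤ (C₀ n^{1/3})³`). [folklore] -/
theorem exists_norm_coeff_le : ∃ C : ℝ, ∀ n : ℕ, ‖coeff χ n‖ ≤ C * n := by
  obtain ⟨C₀, hC₀, h⟩ := Sieve.exists_card_divisors_le_mul_rpow (by norm_num : (0 : ℝ) < 1 / 3)
  refine ⟨C₀ ^ 3, fun n => ?_⟩
  rcases eq_or_ne n 0 with rfl | hn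
  · simp [coeff]
  have hτ := h n hn
  have hν : ‖divisorSumChar χ n‖ ≤ C₀ * (n : ℝ) ^ (1 / 3 : ℝ) := (norm_divisorSumChar_le χ n).trans hτ
  have h0 : 0 ≤ ‖divisorSumChar χ n‖ := norm_nonneg _
  have hn' : (0 : ℝ) < n := by positivity
  rw [coeff, norm_mul, norm_pow, Complex.norm_natCast]
  calc ‖divisorSumChar χ n‖ ^ 2 * (n.divisors.card : ℝ)
      ≤ (C₀ * (n : ℝ) ^ (1 / 3 : ℝ)) ^ 2 * (C₀ * (n : ℝ) ^ (1 / 3 : ℝ)) := by gcongr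
    _ = C₀ ^ 3 * ((n : ℝ) ^ (1 / 3 : ℝ) * (n : ℝ) ^ (1 / 3 : ℝ) * (n : ℝ) ^ (1 / 3 : ℝ)) := by ring
    _ = C₀ ^ 3 * n := by
        rw [← Real.rpow_add hn', ← Real.rpow_add hn']; norm_num

/-- On `re z = 2`: `F(2+iy) = Γ B^{z} L(f,1+z) − Γ A^{z} L(f,1+z)`. [folklore] -/
theorem Fint_line_two (hχ : χ ^ 2 = 1) (y : ℝ) :
    Fint χ A B (2 + y * I) =
      Complex.Gamma (2 + y * I) * (B : ℂ) ^ (2 + y * I : ℂ) * L (coeff χ) (1 + (2 + y * I)) -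
      Complex.Gamma (2 + y * I) * (A : ℂ) ^ (2 + y * I : ℂ) * L (coeff χ) (1 + (2 + y * I)) := by
  have hre : 0 < (2 + y * I : ℂ).re := by simp
  rw [Fint, LSeries_coeff_one_add χ hχ hre]
  ring

/-- **Mellin on `re z = 2`**: integrability and
`∫ F(2+iy) dy = 2π (W_f(B) − W_f(A))`. [folklore] -/
theorem integral_Fint_line_two (hχ : χ ^ 2 = 1) (hA : 0 < A) (hB : 0 < B) :
    Integrable (fun y : ℝ => Fint χ A B (2 + y * I)) ∧
    ∫ y : ℝ, Fint χ A B (2 + y * I) = 2 * π * (W (coeff χ) B - W (coeff χ) A) := by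
  obtain ⟨C, hC⟩ := exists_norm_coeff_le χ
  have I₁ := integrable_Gamma_cpow_LSeries hC hB
  have I₂ := integrable_Gamma_cpow_LSeries hC hA
  have hfun : (fun y : ℝ => Fint χ A B (2 + y * I)) = fun y : ℝ =>
      Complex.Gamma (2 + y * I) * (B : ℂ) ^ (2 + y * I : ℂ) * L (coeff χ) (1 + (2 + y * I)) -
      Complex.Gamma (2 + y * I) * (A : ℂ) ^ (2 + y * I : ℂ) * L (coeff χ) (1 + (2 + y * I)) :=
    funext fun y => Fint_line_two χ hχ y
  rw [hfun]
  have I12 : Integrable fun y : ℝ =>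
      Complex.Gamma (2 + y * I) * (B : ℂ) ^ (2 + y * I : ℂ) * L (coeff χ) (1 + (2 + y * I)) -
      Complex.Gamma (2 + y * I) * (A : ℂ) ^ (2 + y * I : ℂ) * L (coeff χ) (1 + (2 + y * I)) :=
    I₁.sub I₂
  refine ⟨I12, ?_⟩
  rw [integral_sub I₁ I₂, integral_Gamma_cpow_LSeries_eq hC hB, integral_Gamma_cpow_LSeries_eq hC hA]
  ring

/-! ### §3. The smoothed sums are real; the smoothing step -/

omit [NeZero D] in
/-- `f(n) = ν(n)²d(n)` is the real number `|ν(n)|² d(n)` (`χ² = 1`). [folklore] -/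
theorem coeff_eq_ofReal (hχ : χ ^ 2 = 1) (n : ℕ) :
    coeff χ n = ((‖divisorSumChar χ n‖ ^ 2 * (n.divisors.card : ℝ) : ℝ) : ℂ) := by
  rw [coeff, Lemma31.divisorSumChar_sq_eq χ hχ n]
  push_cast
  ring

omit [NeZero D] in
/-- `W_f(Y)` as a real series. [folklore] -/
theorem W_coeff_eq (hχ : χ ^ 2 = 1) (Y : ℝ) :
    W (coeff χ) Y = ((∑' n : ℕ, ‖divisorSumChar χ n‖ ^ 2 * (n.divisors.card : ℝ) *
      Real.exp (-(n / Y)) / n : ℝ) : ℂ) := by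
  have : coeff χ = fun n => ((‖divisorSumChar χ n‖ ^ 2 * (n.divisors.card : ℝ) : ℝ) : ℂ) :=
    funext (coeff_eq_ofReal χ hχ)
  rw [this, W_ofReal]

omit [NeZero D] in
/-- Summability of the real series for `Y > 0`. [folklore] -/
theorem summable_coeff_real {Y : ℝ} (hY : 0 < Y) :
    Summable fun n : ℕ => ‖divisorSumChar χ n‖ ^ 2 * (n.divisors.card : ℝ) *
      Real.exp (-(n / Y)) / n := by
  obtain ⟨C, hC⟩ := exists_norm_coeff_le χ
  refine summable_mul_exp_div (C := C) (fun n => ?_) hY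
  rw [abs_of_nonneg (by positivity)]
  have := hC n
  rwa [coeff, norm_mul, norm_pow, Complex.norm_natCast] at this

omit [NeZero D] in
/-- **The smoothing step**: for `0 < A ≤ M`, `4A ≤ B`, `N ≤ B`,
`∑_{M < n ≤ N} |ν(n)|²d(n)/n ≤ 6 · re (W_f(B) − W_f(A))`. [folklore] -/
theorem sum_Ioc_le (hχ : χ ^ 2 = 1) (hA : 0 < A) (hAB : 4 * A ≤ B) {M N : ℕ}
    (hM : A ≤ M) (hN : (N : ℝ) ≤ B) :
    ∑ n ∈ Finset.Ioc M N, ‖divisorSumChar χ n‖ ^ 2 * (n.divisors.card : ℝ) / n ≤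
      6 * (W (coeff χ) B - W (coeff χ) A).re := by
  have hB : 0 < B := by linarith
  set a : ℕ → ℝ := fun n => ‖divisorSumChar χ n‖ ^ 2 * (n.divisors.card : ℝ) *
    (Real.exp (-(n / B)) - Real.exp (-(n / A))) / n with ha
  have hsB := summable_coeff_real χ hB
  have hsA := summable_coeff_real χ hA
  have hre : (W (coeff χ) B - W (coeff χ) A).re = ∑' n, a n := by
    rw [W_coeff_eq χ hχ, W_coeff_eq χ hχ, ← ofReal_sub, ofReal_re, ← hsB.tsum_sub hsA]
    refine tsum_congr fun n => ?_
    simp only [ha]; ring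
  have ha0 : ∀ n, 0 ≤ a n := by
    intro n
    have : Real.exp (-(n / A)) ≤ Real.exp (-(n / B)) := by
      rw [Real.exp_le_exp, neg_le_neg_iff]
      exact div_le_div_of_nonneg_left (Nat.cast_nonneg n) hA (by linarith)
    simp only [ha]
    exact div_nonneg (mul_nonneg (by positivity) (by linarith)) (Nat.cast_nonneg n)
  have hsa : Summable a := by
    have : a = fun n => ‖divisorSumChar χ n‖ ^ 2 * (n.divisors.card : ℝ) * Real.exp (-(n / B)) / n -
        ‖divisorSumChar χ n‖ ^ 2 * (n.divisors.card : ℝ) * Real.exp (-(n / A)) / n := by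
      funext n; simp only [ha]; ring
    rw [this]; exact hsB.sub hsA
  rw [hre]
  calc ∑ n ∈ Finset.Ioc M N, ‖divisorSumChar χ n‖ ^ 2 * (n.divisors.card : ℝ) / n
      ≤ ∑ n ∈ Finset.Ioc M N, 6 * a n := by
        refine Finset.sum_le_sum fun n hn => ?_
        rw [Finset.mem_Ioc] at hn
        have hAn : A < n := lt_of_le_of_lt hM (by exact_mod_cast hn.1)
        have hnB : (n : ℝ) ≤ B := le_trans (by exact_mod_cast hn.2) hN
        have hw := one_sixth_le_exp_sub_exp hA hAB hAn hnB
        have hn0 : (0 : ℝ) < n := hA.trans hAn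
        simp only [ha]
        rw [mul_div_assoc', div_le_div_iff_of_pos_right hn0]
        have h0 : 0 ≤ ‖divisorSumChar χ n‖ ^ 2 * (n.divisors.card : ℝ) := by positivity
        nlinarith
    _ = 6 * ∑ n ∈ Finset.Ioc M N, a n := by rw [Finset.mul_sum]
    _ ≤ 6 * ∑' n, a n := by
        gcongr
        exact hsa.sum_le_tsum _ fun n _ => ha0 n

/-! ### §4. Bounds in the strip `−1/4 ≤ re z ≤ 2` -/

/-- The absolute constant `P = ∑_p p^{-3/2}` in the bound for `φ♭` on `re w ≥ 3/4`. [folklore] -/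
def Psum : ℝ := ∑' p : Nat.Primes, ((p : ℕ) : ℝ) ^ (-(2 * (3 / 4 : ℝ)))

omit [NeZero D] in
/-- `P ≥ 0`. [folklore] -/
theorem Psum_nonneg : 0 ≤ Psum := tsum_nonneg fun p => by positivity

/-- `‖φ♭(1+z)‖ ≤ 4^{ω(D)} e^{35P}` for `re z ≥ −1/4` (`χ² = 1`). [folklore] -/
theorem norm_phiFlat_one_add_le (hχ : χ ^ 2 = 1) {z : ℂ} (h1 : -(1 / 4) ≤ z.re) :
    ‖phiFlat χ (1 + z)‖ ≤ (4 : ℝ) ^ D.primeFactors.card * Real.exp (35 * Psum) :=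
  norm_phiFlat_le χ hχ (σ₀ := 3 / 4) (by norm_num) (by simp; linarith)

/-- `‖g(z)‖ ≤ (D ‖1+z‖ Z)⁴ · 4^{ω(D)} e^{35P}` for `re z ≥ −1/4` (`χ ≠ 1`, `χ² = 1`). [folklore] -/
theorem norm_gF_le (hχ : χ ^ 2 = 1) (hχ1 : χ ≠ 1) {z : ℂ} (h1 : -(1 / 4) ≤ z.re) :
    ‖gF χ z‖ ≤ ((D : ℝ) * ‖1 + z‖ * Zconst) ^ 4 *
      ((4 : ℝ) ^ D.primeFactors.card * Real.exp (35 * Psum)) := by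
  rw [gF, norm_mul, norm_pow]
  have hL := norm_LFunction_one_add_le χ hχ1 h1
  have hφ := norm_phiFlat_one_add_le χ hχ h1
  have h0 : 0 ≤ ‖χ.LFunction (1 + z)‖ := norm_nonneg _
  gcongr

variable (A B) in
/-- The constant of the strip bound for `F`. [folklore] -/
def KF (D : ℕ) : ℝ :=
  4 ^ 4 * 5 ^ 16 * (4 * CΓ) * MX A B * (((D : ℝ) * Zconst) ^ 4 * 81 *
    ((4 : ℝ) ^ D.primeFactors.card * Real.exp (35 * Psum)))

omit [NeZero D] in
/-- `K_F ≥ 0`. [folklore] -/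
theorem KF_nonneg (hA : 0 < A) (hB : 0 < B) (D : ℕ) : 0 ≤ KF A B D := by
  unfold KF MX
  have := CΓ_pos
  have := Zconst_nonneg
  positivity

/-- **`F` in the strip**: for `χ ≠ 1`, `χ² = 1`, `−1/4 ≤ re z ≤ 2`, `‖z‖ ≥ 1/4`,
`‖F(z)‖ ≤ K_F (1+|im z|)²³ e^{-π|im z|/2}`. [folklore] -/
theorem norm_Fint_le (hχ : χ ^ 2 = 1) (hχ1 : χ ≠ 1) (hA : 0 < A) (hB : 0 < B) {z : ℂ}
    (h1 : -(1 / 4) ≤ z.re) (h2 : z.re ≤ 2) (hz : 1 / 4 ≤ ‖z‖) :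
    ‖Fint χ A B z‖ ≤ KF A B D * ((1 + |z.im|) ^ 23 * Real.exp (-(π * |z.im| / 2))) := by
  have hy0 := abs_nonneg z.im
  have hz0 : z ≠ 0 := by
    intro h; rw [h, norm_zero] at hz; norm_num at hz
  have hzpos : 0 < ‖z‖ := by linarith
  have hzn : ‖z‖ ≤ 2 + |z.im| := by
    have := Complex.norm_le_abs_re_add_abs_im z
    have : |z.re| ≤ 2 := abs_le.2 ⟨by linarith, h2⟩
    linarith
  have h1z : ‖(1 : ℂ) + z‖ ≤ 3 * (1 + |z.im|) := by
    have := norm_add_le (1 : ℂ) z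
    rw [norm_one] at this
    linarith
  have hz1 : (1 : ℂ) + z ≠ 1 := by intro h; exact hz0 (by linear_combination h)
  -- ζ(1+z) = ζ₁(1+z)/z
  have hζ₁ : ‖riemannZeta₁ (1 + z)‖ ≤ 5 ^ 4 * (1 + |z.im|) ^ 4 := by
    have h := BurnolVectors.norm_riemannZeta₁_le (s := 1 + z) (by simp; linarith)
    refine h.trans ?_
    have : ‖(1 : ℂ) + z‖ + 2 ≤ 5 * (1 + |z.im|) := by linarith
    calc (‖(1 : ℂ) + z‖ + 2) ^ 4 ≤ (5 * (1 + |z.im|)) ^ 4 := by gcongr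
      _ = 5 ^ 4 * (1 + |z.im|) ^ 4 := by ring
  have hζ : ‖riemannZeta (1 + z)‖ ≤ 4 * (5 ^ 4 * (1 + |z.im|) ^ 4) := by
    have e : riemannZeta (1 + z) = riemannZeta₁ (1 + z) / z := by
      rw [LFunctions.riemannZeta₁_eq_mul hz1, add_sub_cancel_left]
      field_simp
    rw [e, norm_div, div_le_iff₀ hzpos]
    calc ‖riemannZeta₁ (1 + z)‖ ≤ 5 ^ 4 * (1 + |z.im|) ^ 4 := hζ₁
      _ = 4 * (5 ^ 4 * (1 + |z.im|) ^ 4) * (1 / 4) := by ring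
      _ ≤ 4 * (5 ^ 4 * (1 + |z.im|) ^ 4) * ‖z‖ := by gcongr
  have hζ4 : ‖riemannZeta (1 + z)‖ ^ 4 ≤ 4 ^ 4 * 5 ^ 16 * (1 + |z.im|) ^ 16 := by
    calc ‖riemannZeta (1 + z)‖ ^ 4 ≤ (4 * (5 ^ 4 * (1 + |z.im|) ^ 4)) ^ 4 :=
          pow_le_pow_left₀ (norm_nonneg _) hζ 4
      _ = 4 ^ 4 * 5 ^ 16 * (1 + |z.im|) ^ 16 := by ring
  -- Γ(z) = Γ(z+1)/z
  have hΓ1 : ‖Complex.Gamma (z + 1)‖ ≤ CΓ * (1 + |z.im|) ^ 3 * Real.exp (-(π * |z.im| / 2)) := by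
    have := norm_Gamma_strip_le (x := z.re + 1) (by linarith) (by linarith) z.im
    have e : ((z.re + 1 : ℝ) : ℂ) + z.im * I = z + 1 := by
      rw [show ((z.re + 1 : ℝ) : ℂ) = (z.re : ℂ) + 1 by push_cast; ring]
      conv_rhs => rw [← Complex.re_add_im z]
      ring
    rwa [e] at this
  have hΓ : ‖Complex.Gamma z‖ ≤ 4 * CΓ * (1 + |z.im|) ^ 3 * Real.exp (-(π * |z.im| / 2)) := by
    have e : Complex.Gamma z = Complex.Gamma (z + 1) / z := by
      rw [Complex.Gamma_add_one _ hz0]; field_simp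
    rw [e, norm_div, div_le_iff₀ hzpos]
    have hC := CΓ_pos
    have hE := Real.exp_pos (-(π * |z.im| / 2))
    calc ‖Complex.Gamma (z + 1)‖ ≤ CΓ * (1 + |z.im|) ^ 3 * Real.exp (-(π * |z.im| / 2)) := hΓ1
      _ = 4 * CΓ * (1 + |z.im|) ^ 3 * Real.exp (-(π * |z.im| / 2)) * (1 / 4) := by ring
      _ ≤ 4 * CΓ * (1 + |z.im|) ^ 3 * Real.exp (-(π * |z.im| / 2)) * ‖z‖ := by gcongr
  -- B^z − A^z
  have hAB : ‖(B : ℂ) ^ z - (A : ℂ) ^ z‖ ≤ MX A B := by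
    refine (norm_sub_le _ _).trans ?_
    rw [Complex.norm_cpow_eq_rpow_re_of_pos hB, Complex.norm_cpow_eq_rpow_re_of_pos hA, MX]
    exact add_le_add (rpow_le_rpow_add hB h1 h2) (rpow_le_rpow_add hA h1 h2)
  -- g
  have hΦ : 0 ≤ (4 : ℝ) ^ D.primeFactors.card * Real.exp (35 * Psum) := by positivity
  have hZ0 := Zconst_nonneg
  have hg : ‖gF χ z‖ ≤ ((D : ℝ) * Zconst) ^ 4 * 81 *
      ((4 : ℝ) ^ D.primeFactors.card * Real.exp (35 * Psum)) * (1 + |z.im|) ^ 4 := by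
    refine (norm_gF_le χ hχ hχ1 h1).trans ?_
    calc ((D : ℝ) * ‖(1 : ℂ) + z‖ * Zconst) ^ 4 * ((4 : ℝ) ^ D.primeFactors.card * Real.exp (35 * Psum))
        ≤ ((D : ℝ) * (3 * (1 + |z.im|)) * Zconst) ^ 4 *
            ((4 : ℝ) ^ D.primeFactors.card * Real.exp (35 * Psum)) := by gcongr
      _ = _ := by ring
  -- combine
  have hE := Real.exp_pos (-(π * |z.im| / 2))
  have hC := CΓ_pos
  have hMX : 0 ≤ MX A B := by unfold MX; positivity
  have s1 : ‖riemannZeta (1 + z)‖ ^ 4 * ‖Complex.Gamma z‖ ≤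
      (4 ^ 4 * 5 ^ 16 * (1 + |z.im|) ^ 16) * (4 * CΓ * (1 + |z.im|) ^ 3 * Real.exp (-(π * |z.im| / 2))) :=
    mul_le_mul hζ4 hΓ (norm_nonneg _) (by positivity)
  have s2 : ‖riemannZeta (1 + z)‖ ^ 4 * ‖Complex.Gamma z‖ * ‖(B : ℂ) ^ z - (A : ℂ) ^ z‖ ≤
      (4 ^ 4 * 5 ^ 16 * (1 + |z.im|) ^ 16) * (4 * CΓ * (1 + |z.im|) ^ 3 * Real.exp (-(π * |z.im| / 2))) *
        MX A B :=
    mul_le_mul s1 hAB (norm_nonneg _) (by positivity)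
  have s3 : ‖riemannZeta (1 + z)‖ ^ 4 * ‖Complex.Gamma z‖ * ‖(B : ℂ) ^ z - (A : ℂ) ^ z‖ * ‖gF χ z‖ ≤
      (4 ^ 4 * 5 ^ 16 * (1 + |z.im|) ^ 16) * (4 * CΓ * (1 + |z.im|) ^ 3 * Real.exp (-(π * |z.im| / 2))) *
        MX A B * (((D : ℝ) * Zconst) ^ 4 * 81 *
          ((4 : ℝ) ^ D.primeFactors.card * Real.exp (35 * Psum)) * (1 + |z.im|) ^ 4) :=
    mul_le_mul s2 hg (norm_nonneg _) (by positivity)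
  rw [Fint, norm_mul, norm_mul, norm_mul, norm_pow]
  refine s3.trans (le_of_eq ?_)
  rw [KF]; ring

/-- `y ↦ F(c+iy)` is continuous for `c > −1/2`, `c ≠ 0`. [folklore] -/
theorem continuous_Fint_line (hχ : χ ^ 2 = 1) (hχ1 : χ ≠ 1) (hA : 0 < A) (hB : 0 < B) {c : ℝ}
    (hc : -(1 / 2) < c) (hc0 : c ≠ 0) :
    Continuous fun y : ℝ => Fint χ A B (c + y * I) := by
  have hd := differentiableOn_Fint χ hχ hχ1 hA hB
  have hline : Continuous fun y : ℝ => (c : ℂ) + y * I := by fun_prop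
  refine hd.continuousOn.comp_continuous hline fun y => ⟨?_, ?_⟩
  · simp only [mem_setOf_eq, add_re, ofReal_re, mul_re, I_re, mul_zero, ofReal_im, I_im, mul_one,
      sub_self, add_zero]; exact hc
  · intro h
    have := congrArg Complex.re h
    simp at this
    exact hc0 this

/-- Integrability of `F` on the lines `re z = −1/4` and `re z = 2`. [folklore] -/
theorem integrable_Fint_line (hχ : χ ^ 2 = 1) (hχ1 : χ ≠ 1) (hA : 0 < A) (hB : 0 < B) {c : ℝ}
    (hc : c = -(1 / 4) ∨ c = 2) :
    Integrable fun y : ℝ => Fint χ A B (c + y * I) := by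
  have hc1 : -(1 / 4) ≤ c := by rcases hc with h | h <;> norm_num [h]
  have hc2 : c ≤ 2 := by rcases hc with h | h <;> norm_num [h]
  have hca : 1 / 4 ≤ |c| := by
    rcases hc with h | h <;> (rw [h]; norm_num [abs_of_neg, abs_of_pos])
  have hc0 : c ≠ 0 := by intro h; rw [h] at hca; norm_num at hca
  have hcont := continuous_Fint_line χ hχ hχ1 hA hB (c := c) (by linarith) hc0
  refine (((integrable_pow_mul_exp 23).const_mul (KF A B D)).mono' hcont.aestronglyMeasurable
    (Eventually.of_forall fun y => ?_))
  have hw : 1 / 4 ≤ ‖((c : ℂ) + y * I)‖ := by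
    have hre : (((c : ℂ) + y * I)).re = c := by simp
    have := abs_re_le_norm (((c : ℂ) + y * I))
    rw [hre] at this
    exact hca.trans this
  have him : (((c : ℂ) + y * I)).im = y := by simp
  have hb := norm_Fint_le χ hχ hχ1 hA hB (z := ((c : ℂ) + y * I)) (by simpa using hc1)
    (by simpa using hc2) hw
  rw [him] at hb
  exact hb

/-- Horizontal decay of `F` in the strip. [folklore] -/
theorem Fint_horizontal_decay (hχ : χ ^ 2 = 1) (hχ1 : χ ≠ 1) (hA : 0 < A) (hB : 0 < B)
    (ε : ℝ) (hε : 0 < ε) :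
    ∃ T₀ : ℝ, ∀ T : ℝ, T₀ ≤ |T| → ∀ u ∈ Icc (-(1 / 4) : ℝ) 2, ‖Fint χ A B (u + T * I)‖ ≤ ε := by
  have hK0 := KF_nonneg hA hB D
  obtain ⟨T₁, hT₁⟩ := exists_pow_mul_exp_le 23 hK0 hε
  refine ⟨max T₁ 1, fun T hT u hu => ?_⟩
  have hTT : T₁ ≤ |T| := le_trans (le_max_left _ _) hT
  have hT1 : 1 ≤ |T| := le_trans (le_max_right _ _) hT
  set w : ℂ := (u : ℂ) + T * I with hw
  have hwim : w.im = T := by simp [hw]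
  have hwre : w.re = u := by simp [hw]
  have hwn : 1 / 4 ≤ ‖w‖ := by
    have := abs_im_le_norm w; rw [hwim] at this; linarith
  have hb := norm_Fint_le χ hχ hχ1 hA hB (z := w) (by rw [hwre]; exact hu.1) (by rw [hwre]; exact hu.2) hwn
  rw [hwim] at hb
  exact hb.trans (hT₁ T hTT)

/-! ### §5. The line `re z = −1/4` with the `D`-dependence explicit -/

/-- The absolute constant of the line bound. [folklore] -/
def KlineFlat : ℝ := 4 ^ 5 * 5 ^ 16 * CΓ * (81 * Real.exp 6) * Real.exp (35 * Psum)

omit [NeZero D] in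
/-- `KlineFlat > 0`. [folklore] -/
theorem KlineFlat_pos : 0 < KlineFlat := by unfold KlineFlat; have := CΓ_pos; positivity

/-- **`F` on the line `re z = −1/4`** (`χ` primitive mod `D ≥ 8`, `χ² = 1`):
`‖F(−1/4+iy)‖ ≤ K d(D)² √D (1+𝓛)⁵ (A^{-1/4}+B^{-1/4}) (1+|y|)²³ e^{-π|y|/2}`.
[folklore] -/
theorem norm_Fint_line_le (hχ : χ ^ 2 = 1) (hprim : χ.IsPrimitive) (hD8 : 8 ≤ D)
    (hA : 0 < A) (hB : 0 < B) (y : ℝ) :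
    ‖Fint χ A B (((-(1 / 4) : ℝ) : ℂ) + y * I)‖ ≤
      KlineFlat * (D.divisors.card : ℝ) ^ 2 * Real.sqrt D * (1 + Real.log D) ^ 5 *
        (A ^ (-(1 / 4) : ℝ) + B ^ (-(1 / 4) : ℝ)) * ((1 + |y|) ^ 23 * Real.exp (-(π * |y| / 2))) := by
  have hD0 : D ≠ 0 := by omega
  have hDpos : (0 : ℝ) < D := by exact_mod_cast Nat.pos_of_ne_zero hD0
  have hlog0 : 0 ≤ Real.log D := Real.log_nonneg (by exact_mod_cast Nat.one_le_iff_ne_zero.2 hD0)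
  generalize hzdef : (((-(1 / 4) : ℝ) : ℂ) + y * I) = z
  have hzre : z.re = -(1 / 4) := by rw [← hzdef]; simp
  have hzim : z.im = y := by rw [← hzdef]; simp
  have hy0 := abs_nonneg y
  have hz : 1 / 4 ≤ ‖z‖ := by
    have := Complex.abs_re_le_norm z
    rw [hzre, abs_neg, abs_of_pos (by norm_num : (0:ℝ) < 1 / 4)] at this
    exact this
  have hzpos : 0 < ‖z‖ := by linarith
  have hz0 : z ≠ 0 := by
    intro h; rw [h, norm_zero] at hz; norm_num at hz
  have hzn : ‖z‖ ≤ 1 / 4 + |y| := by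
    have := Complex.norm_le_abs_re_add_abs_im z
    rw [hzre, hzim, abs_neg, abs_of_pos (by norm_num : (0:ℝ) < 1 / 4)] at this
    exact this
  have h1z : ‖(1 : ℂ) + z‖ ≤ 3 * (1 + |y|) := by
    have := norm_add_le (1 : ℂ) z
    rw [norm_one] at this
    linarith
  have hz1 : (1 : ℂ) + z ≠ 1 := by intro h; exact hz0 (by linear_combination h)
  -- ζ(1+z)⁴ Γ(z) as in the strip bound
  have hζ₁ : ‖riemannZeta₁ (1 + z)‖ ≤ 5 ^ 4 * (1 + |y|) ^ 4 := by
    have h := BurnolVectors.norm_riemannZeta₁_le (s := 1 + z) (by rw [add_re, one_re, hzre]; norm_num)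
    refine h.trans ?_
    have : ‖(1 : ℂ) + z‖ + 2 ≤ 5 * (1 + |y|) := by linarith
    calc (‖(1 : ℂ) + z‖ + 2) ^ 4 ≤ (5 * (1 + |y|)) ^ 4 := by gcongr
      _ = 5 ^ 4 * (1 + |y|) ^ 4 := by ring
  have hζ : ‖riemannZeta (1 + z)‖ ≤ 4 * (5 ^ 4 * (1 + |y|) ^ 4) := by
    have e : riemannZeta (1 + z) = riemannZeta₁ (1 + z) / z := by
      rw [LFunctions.riemannZeta₁_eq_mul hz1, add_sub_cancel_left]
      field_simp
    rw [e, norm_div, div_le_iff₀ hzpos]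
    calc ‖riemannZeta₁ (1 + z)‖ ≤ 5 ^ 4 * (1 + |y|) ^ 4 := hζ₁
      _ = 4 * (5 ^ 4 * (1 + |y|) ^ 4) * (1 / 4) := by ring
      _ ≤ 4 * (5 ^ 4 * (1 + |y|) ^ 4) * ‖z‖ := by gcongr
  have hζ4 : ‖riemannZeta (1 + z)‖ ^ 4 ≤ 4 ^ 4 * 5 ^ 16 * (1 + |y|) ^ 16 := by
    calc ‖riemannZeta (1 + z)‖ ^ 4 ≤ (4 * (5 ^ 4 * (1 + |y|) ^ 4)) ^ 4 :=
          pow_le_pow_left₀ (norm_nonneg _) hζ 4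
      _ = 4 ^ 4 * 5 ^ 16 * (1 + |y|) ^ 16 := by ring
  have hΓ1 : ‖Complex.Gamma (z + 1)‖ ≤ CΓ * (1 + |y|) ^ 3 * Real.exp (-(π * |y| / 2)) := by
    have := norm_Gamma_strip_le (x := z.re + 1) (by rw [hzre]; norm_num) (by rw [hzre]; norm_num) z.im
    have e : ((z.re + 1 : ℝ) : ℂ) + z.im * I = z + 1 := by
      rw [show ((z.re + 1 : ℝ) : ℂ) = (z.re : ℂ) + 1 by push_cast; ring]
      conv_rhs => rw [← Complex.re_add_im z]
      ring
    rwa [e, hzim] at this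
  have hC := CΓ_pos
  have hE := Real.exp_pos (-(π * |y| / 2))
  have hΓ : ‖Complex.Gamma z‖ ≤ 4 * CΓ * (1 + |y|) ^ 3 * Real.exp (-(π * |y| / 2)) := by
    have e : Complex.Gamma z = Complex.Gamma (z + 1) / z := by
      rw [Complex.Gamma_add_one _ hz0]; field_simp
    rw [e, norm_div, div_le_iff₀ hzpos]
    calc ‖Complex.Gamma (z + 1)‖ ≤ CΓ * (1 + |y|) ^ 3 * Real.exp (-(π * |y| / 2)) := hΓ1
      _ = 4 * CΓ * (1 + |y|) ^ 3 * Real.exp (-(π * |y| / 2)) * (1 / 4) := by ring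
      _ ≤ 4 * CΓ * (1 + |y|) ^ 3 * Real.exp (-(π * |y| / 2)) * ‖z‖ := by gcongr
  -- B^z − A^z on the line
  have hAB : ‖(B : ℂ) ^ z - (A : ℂ) ^ z‖ ≤ A ^ (-(1 / 4) : ℝ) + B ^ (-(1 / 4) : ℝ) := by
    refine (norm_sub_le _ _).trans ?_
    rw [Complex.norm_cpow_eq_rpow_re_of_pos hB, Complex.norm_cpow_eq_rpow_re_of_pos hA, hzre]
    linarith
  -- L(1+z)⁴ by Pólya–Vinogradov, φ♭ by `norm_phiFlat_le`
  have hsre : ((1 : ℂ) + z).re = 3 / 4 := by rw [add_re, one_re, hzre]; norm_num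
  have hLpv := DirichletAbel.norm_LFunction_le_polyaVinogradov_of_half_le χ hD8 hprim (s := 1 + z)
    (by rw [hsre]; norm_num) (by rw [hsre]; norm_num)
  rw [hsre, show (1 : ℝ) - 3 / 4 = 1 / 4 by norm_num] at hLpv
  have hX4 : ((Real.sqrt D * (1 + Real.log D)) ^ (1 / 4 : ℝ)) ^ 4 = Real.sqrt D * (1 + Real.log D) := by
    have h0 : 0 ≤ Real.sqrt D * (1 + Real.log D) := by positivity
    rw [← Real.rpow_natCast, ← Real.rpow_mul h0]; norm_num
  have hL4 : ‖χ.LFunction (1 + z)‖ ^ 4 ≤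
      81 * Real.exp 6 * Real.sqrt D * (1 + Real.log D) ^ 5 * (1 + |y|) ^ 4 := by
    have h0 : 0 ≤ ‖χ.LFunction (1 + z)‖ := norm_nonneg _
    calc ‖χ.LFunction (1 + z)‖ ^ 4
        ≤ (Real.exp (3 / 2) * (Real.sqrt D * (1 + Real.log D)) ^ (1 / 4 : ℝ) * (1 + Real.log D) *
            ‖(1 : ℂ) + z‖) ^ 4 := pow_le_pow_left₀ h0 hLpv 4
      _ = Real.exp (3 / 2) ^ 4 * ((Real.sqrt D * (1 + Real.log D)) ^ (1 / 4 : ℝ)) ^ 4 *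
            (1 + Real.log D) ^ 4 * ‖(1 : ℂ) + z‖ ^ 4 := by ring
      _ ≤ Real.exp (3 / 2) ^ 4 * ((Real.sqrt D * (1 + Real.log D)) ^ (1 / 4 : ℝ)) ^ 4 *
            (1 + Real.log D) ^ 4 * (3 * (1 + |y|)) ^ 4 := by gcongr
      _ = 81 * Real.exp 6 * Real.sqrt D * (1 + Real.log D) ^ 5 * (1 + |y|) ^ 4 := by
          rw [hX4, ← Real.exp_nat_mul]; norm_num; ring
  have h2 : 2 ^ D.primeFactors.card ≤ D.divisors.card := by
    rw [Nat.card_divisors hD0]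
    refine Finset.pow_card_le_prod _ _ _ fun p hp => ?_
    have hp := Nat.mem_primeFactors.mp hp
    have hpos : 0 < D.factorization p := hp.1.factorization_pos_of_dvd hD0 hp.2.1
    omega
  have hω : (4 : ℝ) ^ D.primeFactors.card ≤ (D.divisors.card : ℝ) ^ 2 := by
    have h2' : (2 : ℝ) ^ D.primeFactors.card ≤ (D.divisors.card : ℝ) := by exact_mod_cast h2
    calc (4 : ℝ) ^ D.primeFactors.card = ((2 : ℝ) ^ D.primeFactors.card) ^ 2 := by
          rw [← pow_mul, mul_comm, pow_mul]; norm_num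
      _ ≤ (D.divisors.card : ℝ) ^ 2 := pow_le_pow_left₀ (by positivity) h2' 2
  have hφ : ‖phiFlat χ (1 + z)‖ ≤ (D.divisors.card : ℝ) ^ 2 * Real.exp (35 * Psum) := by
    refine (norm_phiFlat_one_add_le χ hχ (z := z) (by rw [hzre])).trans ?_
    gcongr
  have hg : ‖gF χ z‖ ≤ (81 * Real.exp 6 * Real.sqrt D * (1 + Real.log D) ^ 5 * (1 + |y|) ^ 4) *
      ((D.divisors.card : ℝ) ^ 2 * Real.exp (35 * Psum)) := by
    rw [gF, norm_mul, norm_pow]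
    exact mul_le_mul hL4 hφ (norm_nonneg _) (by positivity)
  -- combine
  have hAB0 : 0 ≤ A ^ (-(1 / 4) : ℝ) + B ^ (-(1 / 4) : ℝ) := by positivity
  have s1 : ‖riemannZeta (1 + z)‖ ^ 4 * ‖Complex.Gamma z‖ ≤
      (4 ^ 4 * 5 ^ 16 * (1 + |y|) ^ 16) * (4 * CΓ * (1 + |y|) ^ 3 * Real.exp (-(π * |y| / 2))) :=
    mul_le_mul hζ4 hΓ (norm_nonneg _) (by positivity)
  have s2 : ‖riemannZeta (1 + z)‖ ^ 4 * ‖Complex.Gamma z‖ * ‖(B : ℂ) ^ z - (A : ℂ) ^ z‖ ≤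
      (4 ^ 4 * 5 ^ 16 * (1 + |y|) ^ 16) * (4 * CΓ * (1 + |y|) ^ 3 * Real.exp (-(π * |y| / 2))) *
        (A ^ (-(1 / 4) : ℝ) + B ^ (-(1 / 4) : ℝ)) :=
    mul_le_mul s1 hAB (norm_nonneg _) (by positivity)
  have s3 : ‖riemannZeta (1 + z)‖ ^ 4 * ‖Complex.Gamma z‖ * ‖(B : ℂ) ^ z - (A : ℂ) ^ z‖ * ‖gF χ z‖ ≤
      (4 ^ 4 * 5 ^ 16 * (1 + |y|) ^ 16) * (4 * CΓ * (1 + |y|) ^ 3 * Real.exp (-(π * |y| / 2))) *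
        (A ^ (-(1 / 4) : ℝ) + B ^ (-(1 / 4) : ℝ)) *
        ((81 * Real.exp 6 * Real.sqrt D * (1 + Real.log D) ^ 5 * (1 + |y|) ^ 4) *
          ((D.divisors.card : ℝ) ^ 2 * Real.exp (35 * Psum))) :=
    mul_le_mul s2 hg (norm_nonneg _) (by positivity)
  rw [Fint, norm_mul, norm_mul, norm_mul, norm_pow]
  refine s3.trans (le_of_eq ?_)
  rw [KlineFlat]; ring

/-- **The shifted integral** (`χ` primitive mod `D ≥ 8`, `χ² = 1`):
`‖∫ F(−1/4+iy) dy‖ ≤ 8 · 48¹³·… ` — precisely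
`≤ 2 (2·23+2)²³ · K d(D)² √D (1+𝓛)⁵ (A^{-1/4}+B^{-1/4})`. [folklore] -/
theorem norm_integral_Fint_line_le (hχ : χ ^ 2 = 1) (hprim : χ.IsPrimitive) (hD8 : 8 ≤ D)
    (hA : 0 < A) (hB : 0 < B) :
    ‖∫ y : ℝ, Fint χ A B (((-(1 / 4) : ℝ) : ℂ) + y * I)‖ ≤
      2 * 48 ^ 23 * (KlineFlat * (D.divisors.card : ℝ) ^ 2 * Real.sqrt D * (1 + Real.log D) ^ 5 *
        (A ^ (-(1 / 4) : ℝ) + B ^ (-(1 / 4) : ℝ))) := by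
  set K : ℝ := KlineFlat * (D.divisors.card : ℝ) ^ 2 * Real.sqrt D * (1 + Real.log D) ^ 5 *
    (A ^ (-(1 / 4) : ℝ) + B ^ (-(1 / 4) : ℝ)) with hK
  have hD0 : D ≠ 0 := by omega
  have hlog0 : 0 ≤ Real.log D := Real.log_nonneg (by exact_mod_cast Nat.one_le_iff_ne_zero.2 hD0)
  have hK0 : 0 ≤ K := by rw [hK]; have := KlineFlat_pos; positivity
  have hbound : ∀ y : ℝ, ‖Fint χ A B (((-(1 / 4) : ℝ) : ℂ) + y * I)‖ ≤
      K * ((1 + |y|) ^ 23 * Real.exp (-(π * |y| / 2))) := by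
    intro y
    have hb := norm_Fint_line_le χ hχ hprim hD8 hA hB y
    rw [← hK] at hb
    exact hb
  have hint := (integrable_pow_mul_exp 23).const_mul K
  calc ‖∫ y : ℝ, Fint χ A B (((-(1 / 4) : ℝ) : ℂ) + y * I)‖
      ≤ ∫ y : ℝ, K * ((1 + |y|) ^ 23 * Real.exp (-(π * |y| / 2))) :=
        norm_integral_le_of_norm_le hint (Eventually.of_forall hbound)
    _ = K * ∫ y : ℝ, (1 + |y|) ^ 23 * Real.exp (-(π * |y| / 2)) := integral_const_mul _ _
    _ ≤ K * (2 * (2 * (23 : ℕ) + 2) ^ 23) := by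
        gcongr; exact integral_pow_mul_exp_le 23
    _ = 2 * 48 ^ 23 * K := by norm_num; ring

/-! ### §6. Near `z = 0`: the residue of the pole of order four -/

omit [NeZero D] in
/-- `‖ε(z)‖ ≤ 2(log A + log B)` for `A, B ≥ 1`, `z ≠ 0`, `‖z‖ log A ≤ 1`, `‖z‖ log B ≤ 1`
(`|e^w − 1| ≤ 2|w|` for `|w| ≤ 1`). [folklore] -/
theorem norm_eps_le_small (hA : 1 ≤ A) (hB : 1 ≤ B) {z : ℂ} (hz : z ≠ 0)
    (hzA : ‖z‖ * Real.log A ≤ 1) (hzB : ‖z‖ * Real.log B ≤ 1) :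
    ‖eps A B z‖ ≤ 2 * (Real.log A + Real.log B) := by
  have hA0 : (0 : ℝ) < A := by linarith
  have hB0 : (0 : ℝ) < B := by linarith
  have hlA : 0 ≤ Real.log A := Real.log_nonneg hA
  have hlB : 0 ≤ Real.log B := Real.log_nonneg hB
  have hzpos : 0 < ‖z‖ := norm_pos_iff.2 hz
  have eB : (B : ℂ) ^ z = Complex.exp (z * (Real.log B : ℂ)) := by
    rw [Complex.cpow_def_of_ne_zero (ofReal_ne_zero.2 hB0.ne'), ← Complex.ofReal_log hB0.le, mul_comm]
  have eA : (A : ℂ) ^ z = Complex.exp (z * (Real.log A : ℂ)) := by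
    rw [Complex.cpow_def_of_ne_zero (ofReal_ne_zero.2 hA0.ne'), ← Complex.ofReal_log hA0.le, mul_comm]
  have nzB : ‖z * (Real.log B : ℂ)‖ = ‖z‖ * Real.log B := by
    rw [norm_mul, Complex.norm_real, Real.norm_eq_abs, abs_of_nonneg hlB]
  have nzA : ‖z * (Real.log A : ℂ)‖ = ‖z‖ * Real.log A := by
    rw [norm_mul, Complex.norm_real, Real.norm_eq_abs, abs_of_nonneg hlA]
  have nB : ‖Complex.exp (z * (Real.log B : ℂ)) - 1‖ ≤ 2 * (‖z‖ * Real.log B) := by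
    have := Complex.norm_exp_sub_one_le (x := z * (Real.log B : ℂ)) (by rw [nzB]; exact hzB)
    rwa [nzB] at this
  have nA : ‖Complex.exp (z * (Real.log A : ℂ)) - 1‖ ≤ 2 * (‖z‖ * Real.log A) := by
    have := Complex.norm_exp_sub_one_le (x := z * (Real.log A : ℂ)) (by rw [nzA]; exact hzA)
    rwa [nzA] at this
  rw [eps_of_ne_zero _ _ hz, norm_div, div_le_iff₀ hzpos, eB, eA,
    show Complex.exp (z * (Real.log B : ℂ)) - Complex.exp (z * (Real.log A : ℂ)) =
      (Complex.exp (z * (Real.log B : ℂ)) - 1) - (Complex.exp (z * (Real.log A : ℂ)) - 1) by ring]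
  calc ‖(Complex.exp (z * (Real.log B : ℂ)) - 1) - (Complex.exp (z * (Real.log A : ℂ)) - 1)‖
      ≤ ‖Complex.exp (z * (Real.log B : ℂ)) - 1‖ + ‖Complex.exp (z * (Real.log A : ℂ)) - 1‖ :=
        norm_sub_le _ _
    _ ≤ 2 * (‖z‖ * Real.log B) + 2 * (‖z‖ * Real.log A) := add_le_add nB nA
    _ = 2 * (Real.log A + Real.log B) * ‖z‖ := by ring

/-- The absolute constant of the residue bound. [folklore] -/
def Kres : ℝ := (13 / 4 : ℝ) ^ 16 * (2 * CΓ) * Real.exp (35 * Psum) * (1 + 4 * Real.exp (9 / 2)) ^ 4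

omit [NeZero D] in
/-- `Kres ≥ 0`. [folklore] -/
theorem Kres_nonneg : 0 ≤ Kres := by unfold Kres; have := CΓ_pos; positivity

/-- **`h` on the circle `|z| = 𝓛^{-2024}`** (`χ` primitive mod `D`, `χ² = 1`, `𝓛 = log D ≥ 3`,
(A) `‖L(1,χ)‖ ≤ 𝓛^{-2022}`, `1 ≤ A, B`, `log A, log B ≤ 8𝓛`):
`‖h(z)‖ ≤ K_res · 2(log A + log B) · 𝓛^{-8088}`. [cite: Zhang2022LandauSiegel, §3, proof of Lemma 3.1
("the residue at s = 1 is ≪ 𝓛^{-2011}"), four-factor variant] -/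
theorem norm_hnum_le_sphere (hχ : χ ^ 2 = 1) (hprim : χ.IsPrimitive) (hL : 3 ≤ Real.log D)
    (hLA : ‖χ.LFunction 1‖ ≤ 1 / Real.log D ^ 2022) (hA1 : 1 ≤ A) (hB1 : 1 ≤ B)
    (hAL : Real.log A ≤ 8 * Real.log D) (hBL : Real.log B ≤ 8 * Real.log D) {z : ℂ}
    (hz : ‖z‖ = 1 / Real.log D ^ 2024) :
    ‖hnum χ A B z‖ ≤ Kres * (2 * (Real.log A + Real.log B)) / (Real.log D ^ 2022) ^ 4 := by
  set Lg : ℝ := Real.log D with hLdef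
  have hL1 : 1 ≤ Lg := by linarith
  have hL0 : 0 < Lg := by linarith
  have hD0 : D ≠ 0 := by
    rintro rfl; simp [hLdef] at hL; linarith
  have hDpos : (0 : ℝ) < D := by exact_mod_cast Nat.pos_of_ne_zero hD0
  have hlA : 0 ≤ Real.log A := Real.log_nonneg hA1
  have hlB : 0 ≤ Real.log B := Real.log_nonneg hB1
  -- sizes of `r = 𝓛^{-2024}`
  have hL2 : (9 : ℝ) ≤ Lg ^ 2024 := by
    calc (9 : ℝ) = 3 ^ 2 := by norm_num
      _ ≤ Lg ^ 2 := pow_le_pow_left₀ (by norm_num) hL 2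
      _ ≤ Lg ^ 2024 := pow_le_pow_right₀ hL1 (by norm_num)
  have hr9 : ‖z‖ ≤ 1 / 9 := by
    rw [hz]; exact div_le_div_of_nonneg_left (by norm_num) (by norm_num) hL2
  have hrL : ‖z‖ * Lg ≤ 1 / Lg ^ 2023 := by
    rw [hz]
    have : Lg ^ 2024 = Lg ^ 2023 * Lg := by rw [pow_succ]
    rw [this]; field_simp; exact le_rfl
  have hL2023 : (9 : ℝ) ≤ Lg ^ 2023 := by
    calc (9 : ℝ) = 3 ^ 2 := by norm_num
      _ ≤ Lg ^ 2 := pow_le_pow_left₀ (by norm_num) hL 2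
      _ ≤ Lg ^ 2023 := pow_le_pow_right₀ hL1 (by norm_num)
  have hrL1 : ‖z‖ * Lg ≤ 1 := hrL.trans (by rw [div_le_one (by positivity)]; linarith)
  have hrL8 : ‖z‖ * (8 * Lg) ≤ 1 := by
    have : ‖z‖ * (8 * Lg) = 8 * (‖z‖ * Lg) := by ring
    rw [this]
    calc 8 * (‖z‖ * Lg) ≤ 8 * (1 / Lg ^ 2023) := by gcongr
      _ ≤ 1 := by rw [mul_one_div, div_le_one (by positivity)]; linarith
  have hz0 : z ≠ 0 := by
    intro h; rw [h, norm_zero] at hz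
    have : (0 : ℝ) < 1 / Lg ^ 2024 := by positivity
    linarith
  have hz1L : ‖z‖ ≤ 1 / Real.log D := by
    rw [← hLdef]
    calc ‖z‖ = ‖z‖ * Lg / Lg := by field_simp
      _ ≤ 1 / Lg := by gcongr
  have hzre : |z.re| ≤ 1 / 9 := (Complex.abs_re_le_norm z).trans hr9
  have hzim : |z.im| ≤ ‖z‖ := Complex.abs_im_le_norm z
  -- ζ₁(1+z)⁴
  have h1z : ‖(1 : ℂ) + z‖ ≤ 5 / 4 := by
    have := norm_add_le (1 : ℂ) z; rw [norm_one] at this; linarith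
  have hζ₁ : ‖riemannZeta₁ (1 + z)‖ ≤ (13 / 4 : ℝ) ^ 4 := by
    have h := BurnolVectors.norm_riemannZeta₁_le (s := 1 + z)
      (by rw [add_re, one_re]; have := neg_abs_le z.re; linarith)
    refine h.trans ?_
    have : ‖(1 : ℂ) + z‖ + 2 ≤ 13 / 4 := by linarith
    exact pow_le_pow_left₀ (by positivity) this 4
  have hζ4 : ‖riemannZeta₁ (1 + z)‖ ^ 4 ≤ (13 / 4 : ℝ) ^ 16 := by
    calc ‖riemannZeta₁ (1 + z)‖ ^ 4 ≤ ((13 / 4 : ℝ) ^ 4) ^ 4 := pow_le_pow_left₀ (norm_nonneg _) hζ₁ 4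
      _ = (13 / 4 : ℝ) ^ 16 := by norm_num
  -- Γ(z+1)
  have hC := CΓ_pos
  have hΓ : ‖Complex.Gamma (z + 1)‖ ≤ 2 * CΓ := by
    have := norm_Gamma_strip_le (x := z.re + 1) (by have := neg_abs_le z.re; linarith)
      (by have := le_abs_self z.re; linarith) z.im
    have e : ((z.re + 1 : ℝ) : ℂ) + z.im * I = z + 1 := by
      rw [show ((z.re + 1 : ℝ) : ℂ) = (z.re : ℂ) + 1 by push_cast; ring]
      conv_rhs => rw [← Complex.re_add_im z]
      ring
    rw [e] at this
    refine this.trans ?_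
    have hy : |z.im| ≤ 1 / 9 := hzim.trans hr9
    have hE : Real.exp (-(π * |z.im| / 2)) ≤ 1 := by
      rw [Real.exp_le_one_iff]
      have := Real.pi_pos; have := abs_nonneg z.im
      nlinarith
    calc CΓ * (1 + |z.im|) ^ 3 * Real.exp (-(π * |z.im| / 2))
        ≤ CΓ * (1 + 1 / 9) ^ 3 * 1 := by gcongr
      _ ≤ 2 * CΓ := by nlinarith
  -- ε(z)
  have hε : ‖eps A B z‖ ≤ 2 * (Real.log A + Real.log B) :=
    norm_eps_le_small hA1 hB1 hz0
      ((mul_le_mul_of_nonneg_left hAL (norm_nonneg _)).trans hrL8)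
      ((mul_le_mul_of_nonneg_left hBL (norm_nonneg _)).trans hrL8)
  -- L(1+z, χ)⁴ under (A)
  have hLz : ‖χ.LFunction (1 + z)‖ ≤ (1 + 4 * Real.exp (9 / 2)) / Lg ^ 2022 := by
    have hsub := norm_LFunction_one_add_sub_le χ hL hprim hz1L
    rw [← hLdef] at hsub
    have htri := norm_add_le (χ.LFunction (1 + z) - χ.LFunction 1) (χ.LFunction 1)
    rw [sub_add_cancel] at htri
    have hE := Real.exp_pos (9 / 2)
    have h2 : 2 * Real.exp (9 / 2) * (1 + Lg) * Lg * ‖z‖ ≤ 4 * Real.exp (9 / 2) / Lg ^ 2022 := by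
      have h1L : 1 + Lg ≤ 2 * Lg := by linarith
      calc 2 * Real.exp (9 / 2) * (1 + Lg) * Lg * ‖z‖
          ≤ 2 * Real.exp (9 / 2) * (2 * Lg) * Lg * ‖z‖ := by gcongr
        _ = 4 * Real.exp (9 / 2) * Lg * (‖z‖ * Lg) := by ring
        _ ≤ 4 * Real.exp (9 / 2) * Lg * (1 / Lg ^ 2023) := by gcongr
        _ = 4 * Real.exp (9 / 2) / Lg ^ 2022 := by
            have : Lg ^ 2023 = Lg * Lg ^ 2022 := by rw [pow_succ']
            rw [this]; field_simp
    calc ‖χ.LFunction (1 + z)‖ ≤ ‖χ.LFunction (1 + z) - χ.LFunction 1‖ + ‖χ.LFunction 1‖ := htri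
      _ ≤ 2 * Real.exp (9 / 2) * (1 + Lg) * Lg * ‖z‖ + 1 / Lg ^ 2022 := add_le_add hsub hLA
      _ ≤ 4 * Real.exp (9 / 2) / Lg ^ 2022 + 1 / Lg ^ 2022 := by linarith
      _ = (1 + 4 * Real.exp (9 / 2)) / Lg ^ 2022 := by ring
  have hL4 : ‖χ.LFunction (1 + z)‖ ^ 4 ≤ (1 + 4 * Real.exp (9 / 2)) ^ 4 / (Lg ^ 2022) ^ 4 := by
    rw [← div_pow]; exact pow_le_pow_left₀ (norm_nonneg _) hLz 4
  -- φ♭(1+z): absolute bound near the real axis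
  have hφ : ‖phiFlat χ (1 + z)‖ ≤ Real.exp (35 * Psum) := by
    refine norm_phiFlat_le_of_re_cpow_nonneg χ hχ (σ₀ := 3 / 4) (by norm_num) (s := 1 + z)
      (by rw [add_re, one_re]; have := neg_abs_le z.re; linarith) fun p hp hpD => ?_
    refine re_natCast_cpow_neg_nonneg hp.pos ?_
    have hpD' : (p : ℝ) ≤ D := by exact_mod_cast Nat.le_of_dvd (Nat.pos_of_ne_zero hD0) hpD
    have hlogp : Real.log p ≤ Lg := Real.log_le_log (by exact_mod_cast hp.pos) hpD'
    have hlogp0 : 0 ≤ Real.log p := Real.log_nonneg (by exact_mod_cast hp.one_lt.le)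
    have him : |(1 + z : ℂ).im| = |z.im| := by simp
    rw [him]
    calc |z.im| * Real.log p ≤ ‖z‖ * Lg := mul_le_mul hzim hlogp hlogp0 (norm_nonneg _)
      _ ≤ 1 := hrL1
      _ ≤ π / 2 := by linarith [Real.pi_gt_three]
  have hg : ‖gF χ z‖ ≤ (1 + 4 * Real.exp (9 / 2)) ^ 4 / (Lg ^ 2022) ^ 4 * Real.exp (35 * Psum) := by
    rw [gF, norm_mul, norm_pow]
    exact mul_le_mul hL4 hφ (norm_nonneg _) (by positivity)
  -- combine
  have s1 : ‖riemannZeta₁ (1 + z)‖ ^ 4 * ‖Complex.Gamma (z + 1)‖ ≤ (13 / 4 : ℝ) ^ 16 * (2 * CΓ) :=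
    mul_le_mul hζ4 hΓ (norm_nonneg _) (by positivity)
  have s2 : ‖riemannZeta₁ (1 + z)‖ ^ 4 * ‖Complex.Gamma (z + 1)‖ * ‖eps A B z‖ ≤
      (13 / 4 : ℝ) ^ 16 * (2 * CΓ) * (2 * (Real.log A + Real.log B)) :=
    mul_le_mul s1 hε (norm_nonneg _) (by positivity)
  have s3 : ‖riemannZeta₁ (1 + z)‖ ^ 4 * ‖Complex.Gamma (z + 1)‖ * ‖eps A B z‖ * ‖gF χ z‖ ≤
      (13 / 4 : ℝ) ^ 16 * (2 * CΓ) * (2 * (Real.log A + Real.log B)) *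
        ((1 + 4 * Real.exp (9 / 2)) ^ 4 / (Lg ^ 2022) ^ 4 * Real.exp (35 * Psum)) :=
    mul_le_mul s2 hg (norm_nonneg _) (by positivity)
  rw [hnum, norm_mul, norm_mul, norm_mul, norm_pow]
  refine s3.trans (le_of_eq ?_)
  rw [Kres]; field_simp

/-- **Cauchy's estimate for the residue**: under the hypotheses of `norm_hnum_le_sphere`
(and `χ ≠ 1`, `A, B > 0`), `‖h‴(0)‖ ≤ 3! · K_res · 2(log A + log B) · 𝓛^{-8088} / 𝓛^{-3·2024}`.
[folklore] -/
theorem norm_iteratedDeriv_hnum_le (hχ : χ ^ 2 = 1) (hprim : χ.IsPrimitive) (hL : 3 ≤ Real.log D)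
    (hLA : ‖χ.LFunction 1‖ ≤ 1 / Real.log D ^ 2022) (hA1 : 1 ≤ A) (hB1 : 1 ≤ B)
    (hAL : Real.log A ≤ 8 * Real.log D) (hBL : Real.log B ≤ 8 * Real.log D) :
    ‖iteratedDeriv 3 (hnum χ A B) 0‖ ≤
      (Nat.factorial 3 : ℝ) * (Kres * (2 * (Real.log A + Real.log B)) / (Real.log D ^ 2022) ^ 4) /
        (1 / Real.log D ^ 2024) ^ 3 := by
  have hL1 : 1 ≤ Real.log D := by linarith
  have hD0 : D ≠ 0 := by
    rintro rfl; simp at hL; linarith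
  have hq2 : 2 ≤ D := by
    rcases Nat.lt_or_ge D 2 with h | h
    · interval_cases D <;> norm_num at hL
    · exact h
  have hχ1 := ne_one_of_isPrimitive χ hq2 hprim
  set r : ℝ := 1 / Real.log D ^ 2024 with hr
  have hr0 : 0 < r := by positivity
  have hL2 : (9 : ℝ) ≤ Real.log D ^ 2024 := by
    calc (9 : ℝ) = 3 ^ 2 := by norm_num
      _ ≤ Real.log D ^ 2 := pow_le_pow_left₀ (by norm_num) hL 2
      _ ≤ Real.log D ^ 2024 := pow_le_pow_right₀ hL1 (by norm_num)
  have hr9 : r ≤ 1 / 9 := div_le_div_of_nonneg_left (by norm_num) (by norm_num) hL2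
  have hd : DiffContOnCl ℂ (hnum χ A B) (ball 0 r) := by
    refine (differentiableOn_hnum χ hχ hχ1 (by linarith) (by linarith)).diffContOnCl_ball
      fun z hz => ?_
    rw [mem_closedBall, dist_zero_right] at hz
    simp only [mem_setOf_eq]
    have := Complex.abs_re_le_norm z
    have := neg_abs_le z.re
    linarith
  have hM : ∀ z ∈ sphere (0 : ℂ) r,
      ‖hnum χ A B z‖ ≤ Kres * (2 * (Real.log A + Real.log B)) / (Real.log D ^ 2022) ^ 4 := by
    intro z hz
    rw [mem_sphere, dist_zero_right] at hz
    exact norm_hnum_le_sphere χ hχ hprim hL hLA hA1 hB1 hAL hBL hz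
  exact Complex.norm_iteratedDeriv_le_of_forall_mem_sphere_norm_le 3 hr0 hd hM

/-! ### §7. Elementary bookkeeping -/

omit [NeZero D] in
/-- `(1+𝓛)⁵ / D^{1/4} ≤ 32 · 8080^{2020} 𝓛^{-2015}` (`𝓛 = log D ≥ 1`; `log x ≤ x^ε/ε`). [folklore] -/
theorem aux_logpow5 (hL : 1 ≤ Real.log D) (hD0 : (0 : ℝ) < D) :
    (1 + Real.log D) ^ 5 / (D : ℝ) ^ (1 / 4 : ℝ) ≤ 32 * 8080 ^ 2020 / Real.log D ^ 2015 := by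
  set Lg : ℝ := Real.log D with hLdef
  have hL0 : 0 < Lg := by linarith
  have h1 : Lg ≤ (D : ℝ) ^ (1 / 8080 : ℝ) / (1 / 8080) := Real.log_le_rpow_div hD0.le (by norm_num)
  have h2 : Lg / 8080 ≤ (D : ℝ) ^ (1 / 8080 : ℝ) := by
    rw [div_le_iff₀ (by norm_num)]
    have : (D : ℝ) ^ (1 / 8080 : ℝ) / (1 / 8080) = (D : ℝ) ^ (1 / 8080 : ℝ) * 8080 := by ring
    linarith
  have h3 : (Lg / 8080) ^ 2020 ≤ (D : ℝ) ^ (1 / 4 : ℝ) := by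
    calc (Lg / 8080) ^ 2020 ≤ ((D : ℝ) ^ (1 / 8080 : ℝ)) ^ 2020 := pow_le_pow_left₀ (by positivity) h2 _
      _ = (D : ℝ) ^ (1 / 4 : ℝ) := by
          rw [← Real.rpow_natCast, ← Real.rpow_mul hD0.le]; norm_num
  have h4 : (1 + Lg) ^ 5 ≤ 32 * Lg ^ 5 := by
    have : 1 + Lg ≤ 2 * Lg := by linarith
    calc (1 + Lg) ^ 5 ≤ (2 * Lg) ^ 5 := pow_le_pow_left₀ (by linarith) this 5
      _ = 32 * Lg ^ 5 := by ring
  have h5 : 0 < (Lg / 8080) ^ 2020 := by positivity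
  calc (1 + Lg) ^ 5 / (D : ℝ) ^ (1 / 4 : ℝ) ≤ 32 * Lg ^ 5 / (Lg / 8080) ^ 2020 := by
        gcongr
    _ = 32 * 8080 ^ 2020 / Lg ^ 2015 := by
        have hL2020 : Lg ^ 2020 = Lg ^ 5 * Lg ^ 2015 := by rw [← pow_add]
        rw [div_pow, hL2020]
        field_simp

omit [NeZero D] in
/-- Elementary facts about `A = D⁴`, `B = D⁸` for `log D ≥ 3`. [folklore] -/
theorem aux_AB (hL : 3 ≤ Real.log D) :
    0 < (D : ℝ) ^ 4 ∧ 4 * (D : ℝ) ^ 4 ≤ (D : ℝ) ^ 8 ∧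
    ((D : ℝ) ^ 4) ^ (-(1 / 4) : ℝ) + ((D : ℝ) ^ 8) ^ (-(1 / 4) : ℝ) ≤ 2 / D ∧
    1 ≤ (D : ℝ) ^ 4 ∧ 1 ≤ (D : ℝ) ^ 8 ∧
    Real.log ((D : ℝ) ^ 4) ≤ 8 * Real.log D ∧ Real.log ((D : ℝ) ^ 8) ≤ 8 * Real.log D := by
  have hD0 : (0 : ℝ) < D := by
    rcases Nat.eq_zero_or_pos D with h | h
    · rw [h] at hL; simp at hL; linarith
    · exact_mod_cast h
  have hD8 : (8 : ℝ) ≤ D := by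
    have h1 : Real.exp 3 ≤ Real.exp (Real.log D) := Real.exp_le_exp.2 hL
    rw [Real.exp_log hD0] at h1
    linarith [eight_lt_exp_three]
  have hD1 : (1 : ℝ) ≤ D := by linarith
  have hlog0 : 0 ≤ Real.log D := Real.log_nonneg hD1
  refine ⟨by positivity, ?_, ?_, one_le_pow₀ hD1, one_le_pow₀ hD1, ?_, ?_⟩
  · have : (4 : ℝ) ≤ (D : ℝ) ^ 4 := by
      calc (4 : ℝ) ≤ 8 ^ 4 := by norm_num
        _ ≤ (D : ℝ) ^ 4 := pow_le_pow_left₀ (by norm_num) hD8 4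
    nlinarith [pow_nonneg hD0.le 4]
  · have e1 : ((D : ℝ) ^ 4) ^ (-(1 / 4) : ℝ) = 1 / D := by
      rw [← Real.rpow_natCast, ← Real.rpow_mul hD0.le]; norm_num
      exact Real.rpow_neg_one _
    have e2 : ((D : ℝ) ^ 8) ^ (-(1 / 4) : ℝ) = 1 / D ^ 2 := by
      have h8 : (D : ℝ) ^ 8 = ((D : ℝ) ^ 2) ^ 4 := by ring
      rw [h8, ← Real.rpow_natCast ((D : ℝ) ^ 2) 4, ← Real.rpow_mul (by positivity)]; norm_num
      exact Real.rpow_neg_one _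
    rw [e1, e2]
    have h12 : 1 / (D : ℝ) ^ 2 ≤ 1 / D := by
      apply div_le_div_of_nonneg_left (by norm_num) hD0; nlinarith
    have h2D : 2 / (D : ℝ) = 1 / D + 1 / D := by ring
    rw [h2D]; linarith
  · rw [Real.log_pow]; push_cast; linarith
  · rw [Real.log_pow]; push_cast; linarith

/-! ### §8. Lemma 3.2♭ -/

/-- **Lemma 3.2♭ (the cell's four-factor variant of Zhang's Lemma 3.2), kernel-checked**: there is
an absolute constant `C` such that for every `D` with `log D ≥ 3`, every PRIMITIVE Dirichlet character
`χ` mod `D` with `χ² = 1` satisfying (A) `‖L(1,χ)‖ ≤ (log D)^{-2022}`, and every `N ≤ D⁸`,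
`∑_{D⁴ < n ≤ N} |ν(n)|² d(n)/n ≤ C (log D)^{-2015}` (`ν = 1 ∗ χ`, `d` = number of divisors).
[cite: Zhang2022LandauSiegel, §3, Lemma 3.2 (variant: ν²τ₂ in place of ν²τ₂², cf. ALT-1 §4)] -/
theorem lemma_3_2_flat : ∃ C : ℝ, ∀ (D : ℕ) [NeZero D] (χ : DirichletCharacter ℂ D),
    χ.IsPrimitive → χ ^ 2 = 1 → 3 ≤ Real.log D →
    ‖χ.LFunction 1‖ ≤ 1 / Real.log D ^ 2022 →
    ∀ N : ℕ, (N : ℝ) ≤ (D : ℝ) ^ 8 →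
      ∑ n ∈ Finset.Ioc (D ^ 4) N, ‖divisorSumChar χ n‖ ^ 2 * (n.divisors.card : ℝ) / n ≤
        C / Real.log D ^ 2015 := by
  obtain ⟨Cd, hCd1, hCd⟩ := Sieve.exists_card_divisors_le_mul_rpow (by norm_num : (0 : ℝ) < 1 / 8)
  refine ⟨6 * (24 * Kres + 2 * 48 ^ 23 * KlineFlat * Cd ^ 2 * (2 * (32 * 8080 ^ 2020))), ?_⟩
  intro D _ χ hprim hχ2 hL hA N hN
  set M : ℝ := (8080 : ℝ) ^ 2020 with hM
  clear_value M
  set M' : ℝ := (48 : ℝ) ^ 23 with hM'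
  clear_value M'
  set Lg : ℝ := Real.log D with hLdef
  have hL1 : 1 ≤ Lg := by linarith
  have hL0 : 0 < Lg := by linarith
  have hD0 : D ≠ 0 := by
    rintro rfl; simp [hLdef] at hL; linarith
  have hDpos : (0 : ℝ) < D := by exact_mod_cast Nat.pos_of_ne_zero hD0
  have hD8 : 8 ≤ D := by
    have h1 : Real.exp 3 ≤ Real.exp Lg := Real.exp_le_exp.2 hL
    rw [hLdef, Real.exp_log hDpos] at h1
    have := eight_lt_exp_three
    exact_mod_cast (show (8 : ℝ) ≤ D by linarith)
  have hχ1 := ne_one_of_isPrimitive χ (by omega) hprim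
  obtain ⟨hApos, h4AB, hABsum, hA1, hB1, hlogA, hlogB⟩ := aux_AB (D := D) hL
  set A : ℝ := (D : ℝ) ^ 4 with hAdef
  set B : ℝ := (D : ℝ) ^ 8 with hBdef
  have hBpos : 0 < B := by linarith
  -- (1) smoothing
  have hS := sum_Ioc_le χ hχ2 hApos h4AB (M := D ^ 4) (N := N)
    (by rw [hAdef]; push_cast; exact le_rfl) hN
  -- (2) the contour shift across the pole of order four at `z = 0`
  set U : Set ℂ := {z : ℂ | -(1 / 2) < z.re} with hU
  have hUo : IsOpen U := isOpen_lt continuous_const Complex.continuous_re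
  have hstrip := Literature.Analysis.Complex.integral_vertical_sub_eq_sum_of_poles
    (F := Fint χ A B) (σ₁ := -(1 / 4)) (κ := 2) (by norm_num) ({0} : Finset ℂ) (fun _ => 3)
    (fun _ => hnum χ A B) U hUo
    (fun z hz => by
      simp only [mem_preimage, mem_Icc] at hz
      show -(1 / 2) < z.re
      linarith [hz.1])
    (fun p hp => by rw [Finset.mem_singleton] at hp; rw [hp]; simp)
    (by rw [Finset.coe_singleton]; exact differentiableOn_Fint χ hχ2 hχ1 hApos hBpos)
    (fun p hp => by
      rw [Finset.mem_singleton] at hp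
      subst hp
      refine ⟨U, hUo.mem_nhds (by simp [hU]), differentiableOn_hnum χ hχ2 hχ1 hApos hBpos,
        fun z hz hz0 => ?_⟩
      refine Fint_eq_hnum_div χ hz0 fun m hm => ?_
      have hzre : -(1 / 2) < z.re := hz
      rw [hm] at hzre hz0
      simp at hzre
      have : m = 0 := by
        by_contra h
        have : (1 : ℝ) ≤ m := by exact_mod_cast Nat.one_le_iff_ne_zero.2 h
        linarith
      subst this
      simp at hz0)
    (integrable_Fint_line χ hχ2 hχ1 hApos hBpos (Or.inr rfl))
    (integrable_Fint_line χ hχ2 hχ1 hApos hBpos (Or.inl rfl))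
    (Fint_horizontal_decay χ hχ2 hχ1 hApos hBpos)
  rw [Finset.sum_singleton] at hstrip
  -- the line `re z = 2`
  have h2 := (integral_Fint_line_two χ hχ2 hApos hBpos).2
  have e2 : (∫ t : ℝ, Fint χ A B (((2 : ℝ) : ℂ) + t * I)) = ∫ t : ℝ, Fint χ A B (2 + t * I) := by
    norm_num
  rw [e2, h2] at hstrip
  -- so `2π (W(B) − W(A)) = 2π · h‴(0)/3! + ∫_{re z = −1/4} F`
  have hX : 2 * (π : ℂ) * (W (coeff χ) B - W (coeff χ) A) =
      2 * π * (iteratedDeriv 3 (hnum χ A B) 0 / ((Nat.factorial 3 : ℕ) : ℂ)) +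
        ∫ t : ℝ, Fint χ A B ((((-(1 / 4) : ℝ)) : ℂ) + t * I) := sub_eq_iff_eq_add.1 hstrip
  have h2π : ‖(2 * (π : ℂ))‖ = 2 * π := by
    rw [norm_mul, Complex.norm_ofNat, Complex.norm_real, Real.norm_eq_abs, abs_of_pos Real.pi_pos]
  have hnormX : 2 * π * ‖W (coeff χ) B - W (coeff χ) A‖ ≤
      2 * π * ‖iteratedDeriv 3 (hnum χ A B) 0 / ((Nat.factorial 3 : ℕ) : ℂ)‖ +
        ‖∫ t : ℝ, Fint χ A B ((((-(1 / 4) : ℝ)) : ℂ) + t * I)‖ := by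
    have h := congrArg (fun w : ℂ => ‖w‖) hX
    simp only [norm_mul, h2π] at h
    rw [h]
    refine (norm_add_le _ _).trans (le_of_eq ?_)
    rw [norm_mul, h2π]
  have hΔn0 : ‖W (coeff χ) B - W (coeff χ) A‖ ≤
      ‖iteratedDeriv 3 (hnum χ A B) 0 / ((Nat.factorial 3 : ℕ) : ℂ)‖ +
        ‖∫ t : ℝ, Fint χ A B ((((-(1 / 4) : ℝ)) : ℂ) + t * I)‖ := by
    have hπ3 := Real.pi_gt_three
    have hI0 := norm_nonneg (∫ t : ℝ, Fint χ A B ((((-(1 / 4) : ℝ)) : ℂ) + t * I))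
    have h1 : ‖∫ t : ℝ, Fint χ A B ((((-(1 / 4) : ℝ)) : ℂ) + t * I)‖ ≤
        2 * π * ‖∫ t : ℝ, Fint χ A B ((((-(1 / 4) : ℝ)) : ℂ) + t * I)‖ := by nlinarith
    have h2 : 2 * π * ‖W (coeff χ) B - W (coeff χ) A‖ ≤
        2 * π * (‖iteratedDeriv 3 (hnum χ A B) 0 / ((Nat.factorial 3 : ℕ) : ℂ)‖ +
          ‖∫ t : ℝ, Fint χ A B ((((-(1 / 4) : ℝ)) : ℂ) + t * I)‖) := by linarith
    exact le_of_mul_le_mul_left h2 (by positivity)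
  -- (3) the residue term
  have hres := norm_iteratedDeriv_hnum_le χ hχ2 hprim hL hA hA1 hB1 hlogA hlogB
  have hfac : ((Nat.factorial 3 : ℕ) : ℝ) = 6 := by norm_num [Nat.factorial]
  have hT1 : ‖iteratedDeriv 3 (hnum χ A B) 0 / ((Nat.factorial 3 : ℕ) : ℂ)‖ ≤ 24 * Kres / Lg ^ 2015 := by
    rw [norm_div, Complex.norm_natCast, hfac]
    rw [hfac, ← hLdef] at hres
    have hK := Kres_nonneg
    have hsum : Real.log A + Real.log B ≤ 12 * Lg := by
      rw [hAdef, hBdef, Real.log_pow, Real.log_pow, ← hLdef]; push_cast; linarith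
    have step : 6 * (Kres * (2 * (Real.log A + Real.log B)) / (Lg ^ 2022) ^ 4) / (1 / Lg ^ 2024) ^ 3 ≤
        6 * (Kres * (2 * (12 * Lg)) / (Lg ^ 2022) ^ 4) / (1 / Lg ^ 2024) ^ 3 := by
      gcongr
    have e : 6 * (Kres * (2 * (12 * Lg)) / (Lg ^ 2022) ^ 4) / (1 / Lg ^ 2024) ^ 3 =
        6 * (24 * Kres / Lg ^ 2015) := by
      have h8088 : (Lg ^ 2022) ^ 4 = Lg ^ 2015 * Lg * (Lg ^ 2024) ^ 3 := by
        rw [← pow_mul, ← pow_mul, ← pow_succ, ← pow_add]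
      rw [h8088]
      field_simp
      ring
    rw [div_le_iff₀ (by norm_num : (0 : ℝ) < 6)]
    calc ‖iteratedDeriv 3 (hnum χ A B) 0‖
        ≤ 6 * (Kres * (2 * (Real.log A + Real.log B)) / (Lg ^ 2022) ^ 4) / (1 / Lg ^ 2024) ^ 3 := hres
      _ ≤ 6 * (24 * Kres / Lg ^ 2015) := step.trans (le_of_eq e)
      _ = 24 * Kres / Lg ^ 2015 * 6 := by ring
  -- (4) the shifted integral
  have hT2 : ‖∫ t : ℝ, Fint χ A B ((((-(1 / 4) : ℝ)) : ℂ) + t * I)‖ ≤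
      2 * M' * KlineFlat * Cd ^ 2 * (2 * (32 * M)) / Lg ^ 2015 := by
    have hI := norm_integral_Fint_line_le χ hχ2 hprim hD8 hApos hBpos
    rw [← hM'] at hI
    set t : ℝ := (D : ℝ) ^ (1 / 8 : ℝ) with htdef
    have ht0 : 0 < t := by positivity
    have ht2 : (D : ℝ) ^ (1 / 4 : ℝ) = t ^ 2 := by
      rw [htdef, ← Real.rpow_natCast, ← Real.rpow_mul hDpos.le]; norm_num
    have ht4 : Real.sqrt D = t ^ 4 := by
      rw [Real.sqrt_eq_rpow, htdef, ← Real.rpow_natCast, ← Real.rpow_mul hDpos.le]; norm_num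
    have ht8 : (D : ℝ) = t ^ 8 := by
      rw [htdef, ← Real.rpow_natCast, ← Real.rpow_mul hDpos.le]; norm_num
    have hτ : (D.divisors.card : ℝ) ≤ Cd * t := hCd D hD0
    have hτ2 : (D.divisors.card : ℝ) ^ 2 ≤ (Cd * t) ^ 2 := pow_le_pow_left₀ (Nat.cast_nonneg _) hτ 2
    have hlp := aux_logpow5 (D := D) hL1 hDpos
    rw [ht2, ← hLdef, ← hM] at hlp
    have hK := KlineFlat_pos
    have hM'0 : 0 ≤ M' := by rw [hM']; positivity
    have hmain : KlineFlat * (D.divisors.card : ℝ) ^ 2 * Real.sqrt D * (1 + Lg) ^ 5 *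
        (A ^ (-(1 / 4) : ℝ) + B ^ (-(1 / 4) : ℝ)) ≤ KlineFlat * Cd ^ 2 * (2 * (32 * M / Lg ^ 2015)) := by
      calc KlineFlat * (D.divisors.card : ℝ) ^ 2 * Real.sqrt D * (1 + Lg) ^ 5 *
            (A ^ (-(1 / 4) : ℝ) + B ^ (-(1 / 4) : ℝ))
          ≤ KlineFlat * (Cd * t) ^ 2 * t ^ 4 * (1 + Lg) ^ 5 * (2 / D) := by
            rw [ht4]; gcongr
        _ = KlineFlat * Cd ^ 2 * (2 * ((1 + Lg) ^ 5 / t ^ 2)) := by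
            rw [ht8]; field_simp
        _ ≤ KlineFlat * Cd ^ 2 * (2 * (32 * M / Lg ^ 2015)) := by gcongr
    calc ‖∫ t : ℝ, Fint χ A B ((((-(1 / 4) : ℝ)) : ℂ) + t * I)‖
        ≤ 2 * M' * (KlineFlat * (D.divisors.card : ℝ) ^ 2 * Real.sqrt D * (1 + Real.log D) ^ 5 *
            (A ^ (-(1 / 4) : ℝ) + B ^ (-(1 / 4) : ℝ))) := hI
      _ ≤ 2 * M' * (KlineFlat * Cd ^ 2 * (2 * (32 * M / Lg ^ 2015))) := by
          rw [← hLdef]; gcongr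
      _ = 2 * M' * KlineFlat * Cd ^ 2 * (2 * (32 * M)) / Lg ^ 2015 := by ring
  -- (5) combine
  have hΔn : ‖W (coeff χ) B - W (coeff χ) A‖ ≤
      (24 * Kres + 2 * M' * KlineFlat * Cd ^ 2 * (2 * (32 * M))) / Lg ^ 2015 := by
    refine hΔn0.trans ?_
    rw [add_div]
    exact add_le_add hT1 hT2
  calc ∑ n ∈ Finset.Ioc (D ^ 4) N, ‖divisorSumChar χ n‖ ^ 2 * (n.divisors.card : ℝ) / n
      ≤ 6 * (W (coeff χ) B - W (coeff χ) A).re := hS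
    _ ≤ 6 * ‖W (coeff χ) B - W (coeff χ) A‖ := by gcongr; exact Complex.re_le_norm _
    _ ≤ 6 * ((24 * Kres + 2 * M' * KlineFlat * Cd ^ 2 * (2 * (32 * M))) / Lg ^ 2015) := by gcongr
    _ = _ := by rw [hLdef]; ring

end Literature.NumberTheory.LFunctions.Zhang2022.Lemma32Flat

end
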